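import Summits.HodgeConjecture.HodgeConjecture.Theorems.F0P3cStCharTSWeylHypFibre      -- ★ (A0) `mem_torusU_iff_forall_apply_eq_zero`, (A0′) `isUnit_sub_of_isRegularElt_glDiagonal`, (A1) `centralizer_eq_torusU_of_isRegularElt` (all generic `N`)
import Summits.HodgeConjecture.HodgeConjecture.Theorems.F0P3cStCharTSWeylHypTorsor     -- ★ `antidiag_mul_antidiag_apply_eq_zero` (generic `N`)
import Summits.HodgeConjecture.HodgeConjecture.Theorems.F0P3cStCharTSWeylHypMeasure    -- ★ `isRegularElt_glDiagonal_of_isUnit_sub` (generic `N`)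
import Summits.HodgeConjecture.HodgeConjecture.Theorems.F0P3cStCharTSWeylCartanFibre   -- ★ (E1a) generic `W`-free kit: `exists_isOpen_wFree_nhds`, `subsingleton_preimage_inter_prod`
import Summits.HodgeConjecture.HodgeConjecture.Theorems.F0P3bBorelCharactersUnipotentTwo -- ★ `glDiagonal_two_mem_unitaryGroupOfForm` (`d(α, α⁻¹) ∈ U(σ, Φ₂)`)
import Literature.NumberTheory.Automorphic.JacquetNonzeroEmbedsNormalizedInd           -- ★ `torusU_mul_comm` (the diagonal torus is abelian, generic `N`)
import HarnessLib

/-!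
# F0 · P3c · ROAD «UP-TR» ∕ sub-road «JAC-LOC₂» — brick (B4) «NORM₂»: the normaliser of the diagonal torus of `U(σ, Φ₂)(R)` is `T ⊔ w·T`, `|N(T)∕T| = 2`,
# and the `W`-free ∕ one-point-fibre inputs of the tube-Jacobian socket at the split Cartan of `U(1,1)` (Rogawski 1990 §12.5 p. 182; van Dijk 1972 §2)

Cell `pub/hodgecm-mathlib`, crux H413 = `stmt-HodgeConjecture-24833` (lane `--kind proof --supports … --as helper`); seat LH4-p02 (g10); ROAD «UP-TR» (LEAD T14-21, holder
F0P3-p02 (g23)), sub-road «JAC-LOC₂» (LH7-p02 (g8), memo `ROAD-JAC-LOC2.v1` ebe7871d §3), brick **(B4) NORM₂**.  THEOREMS ONLY; sorry-free; no definition ∕ instance ∕ notation ∕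
named fact; ★-only imports; axioms TRIO.  Count-neutral.
SETTING.  `U := ↥(unitaryGroupOfForm σ J)`, `[CommRing R]`, `σ : R →+* R`, `T := torusU σ J`; `R` FIELD-LIKE (`x ≠ 0 → IsUnit x`: trivial on the one-place MODEL `U(σ,Φ₂)(K)` of
(B7); ★ `isUnit_of_ne_zero_of_nonsplit` on the CM carrier at a non-split place) and `T` with ONE regular element (`hex`, supplied by §5).  This is the `N = 2` twin of ★ (A2)
`F0P3cStCharTSWeylHypNormaliser` ∕ ★ (B1) `F0P3cStCharTSWeylHypTorsor` §Weyl ∕ ★ `F0P3cStCharTSWeylHypMeasure.index_torusU_subgroupOf_normalizer_eq_two` (all `N = 3`) — simpler: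
at `N = 2` every monomial matrix is diagonal or anti-diagonal, so ★ (A2)'s unitarity step disappears and §2 holds for EVERY form `J`.
§1 `Φ₂` entries; the Weyl unit (matrix `Φ₂`) lies in `U(σ,Φ₂)` (over a field = ★ `weylLongU σ hJ`, ★ `coe_coe_weylLongU`) · §2 **`mem_normalizer_torusU_two_iff`**: `g ∈ N(T)` iff
the matrix of `g` is diagonal or anti-diagonal · §3 Weyl lemmas for a free `w` with `hw : matrix w = J = Φ₂` (★ (B1)'s shape) and the letter's form
**`mem_normalizer_torusU_two_iff_mem_or_mul_weyl_mem`**: `n ∈ N(T) ↔ n ∈ T ∨ n·w ∈ T` · §4 **`index_torusU_subgroupOf_normalizer_two_eq_two`**: `[N(T) : T] = 2` (the S9d ∕ (N3)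
Weyl VALUE at the split torus of `U(Φ₂)`; `≠ 0` = the engine's `hW`) · §5 `hex` supplier `exists_mem_torusU_isRegularElt_two` (`d(α, α⁻¹)`, `σ α = α`, `α − α⁻¹` a unit) · §6 the
(E1a) kit AT `(U, T, regular)` by ONE `exact` each: **`exists_isOpen_wFree_nhds_torusU_two`** (`W`-free neighbourhoods of regular points of `T`) and
**`injOn_conjFamily_torusU`** (one-point fibres of `Φ(x̄,t) = x t x⁻¹` over a `W`-free `V` — (B7)'s injectivity input).
HONEST LABEL: HC_CM is proved only modulo the 7 printed citations (2 remaining: hLiu418 = `stmt-HodgeConjecture-24832`, h413 = `stmt-HodgeConjecture-24833`) until rung 0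
closes; count-neutral group theory for the (H4s) tube Jacobian; closes no organ; block consequents move only at the rider editions.

## References
* [Rogawski1990] J. D. Rogawski, *Automorphic Representations of Unitary Groups in Three Variables*, Ann. of Math. Stud. 123 (1990), §12.5 p. 182, §1.10 p. 9, §3.1 p. 19.
* [vanDijk1972] G. van Dijk, *Computation of certain induced characters of `p`-adic groups*, Math. Ann. 199 (1972), §2.
* [HarishChandra1970] Harish-Chandra (notes by G. van Dijk), *Harmonic analysis on reductive `p`-adic groups*, LNM 162 (1970), Lemma 22, Lemma 42.
* [SpringerLAG1998] T. A. Springer, *Linear Algebraic Groups*, 2nd ed. (1998), 7.1.5.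
-/

set_option autoImplicit false
set_option linter.dupNamespace false

open Matrix Polynomial Set
open Literature.NumberTheory.Automorphic Literature.NumberTheory.Automorphic.UnitaryGroup Literature.NumberTheory.Rogawski1990
open Summit.HodgeConjecture.HodgeConjecture.Cruxes.H413.F0P3cStCharTSWeylHypFibre
open Summit.HodgeConjecture.HodgeConjecture.Cruxes.H413.F0P3cStCharTSWeylHypTorsor
open Summit.HodgeConjecture.HodgeConjecture.Cruxes.H413.F0P3cStCharTSWeylHypMeasure
open Summit.HodgeConjecture.HodgeConjecture.Cruxes.H413.F0P3cStCharTSWeylCartanFibre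
open Summit.HodgeConjecture.HodgeConjecture.Cruxes.H413.F0P3bBorelCharactersUnipotentTwo
open scoped MatrixGroups

namespace Summit.HodgeConjecture.HodgeConjecture.Cruxes.H413.F0P3cStCharTSUpTrU2Norm

/-! ## §1 `Φ₂` bookkeeping and the Weyl unit -/

section PhiTwo

variable {R : Type*} [CommRing R] (σ : R →+* R)

/-- Entries of `Φ₂ = (StdForm.antidiagonal 2).over R`: `1` on the anti-diagonal, `0` on the diagonal. [cite: Rogawski1990, §1.9 p. 8] -/
theorem antidiagonal_two_over_apply (i j : Fin 2) : ((StdForm.antidiagonal 2).over R) i j = if j = i.rev then (1 : R) else 0 := by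
  rw [StdForm.over, Matrix.map_apply, StdForm.antidiagonal_J_apply]
  split_ifs <;> simp

/-- **The Weyl unit `w₀` of `U(σ, Φ₂)`**: the unit with matrix `Φ₂` (`Φ₂² = 1`) lies in `U(σ, Φ₂)(R)`. [cite: Rogawski1990, §12.5 p. 182; §1.10 p. 9] -/
theorem antidiagOne_two_mem_unitaryGroupOfForm {J : Matrix (Fin 2) (Fin 2) R} (hJ : J = (StdForm.antidiagonal 2).over R) :
    (⟨J, J, by rw [hJ, StdForm.over_mul_over], by rw [hJ, StdForm.over_mul_over]⟩ : GL (Fin 2) R) ∈ unitaryGroupOfForm σ J := by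
  rw [mem_unitaryGroupOfForm_iff]
  show (J.map σ)ᵀ * J * J = J
  have hmap : J.map σ = J := by
    rw [hJ]; ext i j; rw [Matrix.map_apply, antidiagonal_two_over_apply]; split_ifs <;> simp
  rw [hmap, hJ, StdForm.transpose_over, Matrix.mul_assoc, StdForm.over_mul_over, Matrix.mul_one]

end PhiTwo

/-! ## §2 The normaliser of the diagonal torus of `U(σ, J)(R)`, `N = 2`: diagonal or anti-diagonal -/

section Normaliser

variable {R : Type*} [CommRing R] (σ : R →+* R) {J : Matrix (Fin 2) (Fin 2) R}

/-- **(B4) `N_U(T) = T ⊔ w·T` for `U = U(σ, J)(R)`, `N = 2`, ANY form `J`, over a field-like nontrivial `R` whose diagonal torus has a REGULAR element**: `g` normalises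
`T = torusU σ J` iff its matrix is DIAGONAL (`g ∈ T`) or ANTI-DIAGONAL (`g ∈ w·T`).  (⇒) conjugating the regular `m = diag(d)` by `g` gives a diagonal `m′ = g⁻¹ m g = diag(d′)`
with `g_{ij}(d′_j − d_i) = 0`, `d, d′` with unit differences, so every row and every column of `g` has exactly one non-zero entry — at `N = 2` such a matrix is diagonal or
anti-diagonal (no unitarity step, unlike ★ (A2) at `N = 3`).  (⇐) diagonal and anti-diagonal invertible matrices conjugate diagonal matrices to diagonal matrices.
[cite: Rogawski1990, §12.5 p. 182] [cite: SpringerLAG1998, 7.1.5] [cite: vanDijk1972, §2] -/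
theorem mem_normalizer_torusU_two_iff [Nontrivial R] (hR : ∀ x : R, x ≠ 0 → IsUnit x)
    (hex : ∃ m : ↥(unitaryGroupOfForm σ J), m ∈ torusU σ J ∧ IsRegularElt (m : GL (Fin 2) R))
    (g : ↥(unitaryGroupOfForm σ J)) :
    g ∈ Subgroup.normalizer (torusU σ J : Set ↥(unitaryGroupOfForm σ J)) ↔
      (∀ i j : Fin 2, i ≠ j → ((g : GL (Fin 2) R) : Matrix (Fin 2) (Fin 2) R) i j = 0) ∨
        (∀ i j : Fin 2, j ≠ i.rev → ((g : GL (Fin 2) R) : Matrix (Fin 2) (Fin 2) R) i j = 0) := by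
  set G : Matrix (Fin 2) (Fin 2) R := ((g : GL (Fin 2) R) : Matrix (Fin 2) (Fin 2) R) with hG
  set G' : Matrix (Fin 2) (Fin 2) R := (((g : GL (Fin 2) R)⁻¹ : GL (Fin 2) R) : Matrix (Fin 2) (Fin 2) R) with hG'
  have hGG' : G * G' = 1 := by rw [hG, hG', ← Units.val_mul, mul_inv_cancel, Units.val_one]
  have hG'G : G' * G = 1 := by rw [hG, hG', ← Units.val_mul, inv_mul_cancel, Units.val_one]
  have hrev0 : (0 : Fin 2).rev = 1 := rfl; have hrev1 : (1 : Fin 2).rev = 0 := rfl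
  constructor
  · intro hg
    obtain ⟨m, hmT, hmreg⟩ := hex
    obtain ⟨d, hd⟩ := hmT
    have hd' : glDiagonal 2 R d = (m : GL (Fin 2) R) := by rw [hd, Subgroup.coe_subtype]
    have hm'T : g⁻¹ * m * g ∈ torusU σ J := (Subgroup.mem_normalizer_iff''.1 hg m).1 ⟨d, hd⟩
    obtain ⟨d', hdd'⟩ := hm'T
    have hd'' : glDiagonal 2 R d' = ((g⁻¹ * m * g : ↥(unitaryGroupOfForm σ J)) : GL (Fin 2) R) := by rw [hdd', Subgroup.coe_subtype]
    have hregd : ∀ i j : Fin 2, i ≠ j → IsUnit ((d i : R) - d j) := fun i j hij =>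
      isUnit_sub_of_isRegularElt_glDiagonal (by rw [hd']; exact hmreg) hij
    have hregd' : ∀ i j : Fin 2, i ≠ j → IsUnit ((d' i : R) - d' j) := fun i j hij => by
      refine isUnit_sub_of_isRegularElt_glDiagonal ?_ hij
      rw [hd'', Subgroup.coe_mul, Subgroup.coe_mul, Subgroup.coe_inv]
      have e : ((g : GL (Fin 2) R))⁻¹ * (m : GL (Fin 2) R) * (g : GL (Fin 2) R) =
          ((g : GL (Fin 2) R))⁻¹ * (m : GL (Fin 2) R) * (((g : GL (Fin 2) R))⁻¹)⁻¹ := by rw [inv_inv]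
      rw [e, isRegularElt_conj_iff]
      exact hmreg
    have hmat : ((m : GL (Fin 2) R) : Matrix (Fin 2) (Fin 2) R) = diagonal fun k => (d k : R) := by rw [← hd', coe_glDiagonal]
    have hmat' : G' * (diagonal fun k => (d k : R)) * G = diagonal fun k => (d' k : R) := by
      have h := congrArg (fun x : GL (Fin 2) R => (x : Matrix (Fin 2) (Fin 2) R)) hd''
      rw [coe_glDiagonal, Subgroup.coe_mul, Subgroup.coe_mul, Subgroup.coe_inv, Units.val_mul, Units.val_mul, hmat] at h
      exact h.symm
    have hrel : G * (diagonal fun k => (d' k : R)) = (diagonal fun k => (d k : R)) * G := by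
      rw [← hmat', ← Matrix.mul_assoc, ← Matrix.mul_assoc, hGG', Matrix.one_mul]
    have key : ∀ i j : Fin 2, G i j ≠ 0 → (d i : R) = d' j := by
      intro i j hij
      have e := congrFun (congrFun hrel i) j
      rw [mul_diagonal, diagonal_mul] at e
      have e2 : G i j * ((d' j : R) - d i) = 0 := by rw [mul_sub, e]; ring
      exact (sub_eq_zero.1 (((hR _ hij).mul_right_eq_zero).1 e2)).symm
    have rowuniq : ∀ i j k : Fin 2, G i j ≠ 0 → G i k ≠ 0 → j = k := by
      intro i j k hj hk
      by_contra hjk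
      have hu := hregd' j k hjk
      rw [← key i j hj, ← key i k hk, sub_self] at hu
      exact not_isUnit_zero hu
    have coluniq : ∀ i i' j : Fin 2, G i j ≠ 0 → G i' j ≠ 0 → i = i' := by
      intro i i' j hi hi'
      by_contra hii
      have hu := hregd i i' hii
      rw [key i j hi, key i' j hi', sub_self] at hu
      exact not_isUnit_zero hu
    have rowex : ∀ i : Fin 2, ∃ j, G i j ≠ 0 := by
      intro i
      by_contra h
      push Not at h
      have e := congrFun (congrFun hGG' i) i
      rw [Matrix.mul_apply, Matrix.one_apply_eq, Finset.sum_eq_zero (fun k _ => by rw [h k, zero_mul])] at e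
      exact zero_ne_one e
    by_cases hG00 : G 0 0 = 0
    · -- anti-diagonal
      right
      have hG01 : G 0 1 ≠ 0 := by
        obtain ⟨j, hj⟩ := rowex 0
        fin_cases j
        · exact absurd hG00 hj
        · exact hj
      have hG11 : G 1 1 = 0 := by by_contra h; exact absurd (coluniq 0 1 1 hG01 h) (by decide)
      intro i j hij
      fin_cases i <;> fin_cases j
      · exact hG00
      · exact absurd hrev0.symm hij
      · exact absurd hrev1.symm hij
      · exact hG11
    · -- diagonal
      left
      have hG01 : G 0 1 = 0 := by by_contra h; exact absurd (rowuniq 0 0 1 hG00 h) (by decide)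
      have hG10 : G 1 0 = 0 := by by_contra h; exact absurd (coluniq 0 1 0 hG00 h) (by decide)
      intro i j hij
      fin_cases i <;> fin_cases j
      · exact absurd rfl hij
      · exact hG01
      · exact hG10
      · exact absurd rfl hij
  · -- (⇐)
    rintro (hdiag | hanti)
    · exact Subgroup.le_normalizer ((mem_torusU_iff_forall_apply_eq_zero σ J g).2 hdiag)
    · -- `g` anti-diagonal: its inverse is anti-diagonal too, and `g t g⁻¹` is diagonal for diagonal `t`
      have hz : ∀ i j : Fin 2, j ≠ i.rev → G i j = 0 := hanti
      have hG00 : G 0 0 = 0 := hz 0 0 (by decide)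
      have hG11 : G 1 1 = 0 := hz 1 1 (by decide)
      have hu01 : IsUnit (G 0 1) := by
        have e := congrFun (congrFun hGG' 0) 0
        simp only [Matrix.mul_apply, Fin.sum_univ_two, Matrix.one_apply_eq, hG00, zero_mul, zero_add] at e
        exact IsUnit.of_mul_eq_one _ e
      have hu10 : IsUnit (G 1 0) := by
        have e := congrFun (congrFun hGG' 1) 1
        simp only [Matrix.mul_apply, Fin.sum_univ_two, Matrix.one_apply_eq, hG11, zero_mul, add_zero] at e
        exact IsUnit.of_mul_eq_one _ e
      have hG'11 : G' 1 1 = 0 := by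
        have e := congrFun (congrFun hGG' 0) 1
        rw [Matrix.one_apply_ne (by decide)] at e
        simp only [Matrix.mul_apply, Fin.sum_univ_two, hG00, zero_mul, zero_add] at e
        exact (hu01.mul_right_eq_zero).1 e
      have hG'00 : G' 0 0 = 0 := by
        have e := congrFun (congrFun hGG' 1) 0
        rw [Matrix.one_apply_ne (by decide)] at e
        simp only [Matrix.mul_apply, Fin.sum_univ_two, hG11, zero_mul, add_zero] at e
        exact (hu10.mul_right_eq_zero).1 e
      rw [Subgroup.mem_normalizer_iff]
      intro t
      constructor
      · rintro ⟨e, he⟩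
        have hte : ((t : GL (Fin 2) R) : Matrix (Fin 2) (Fin 2) R) = diagonal fun k => (e k : R) := by
          rw [← coe_glDiagonal, he, Subgroup.coe_subtype]
        refine (mem_torusU_iff_forall_apply_eq_zero σ J _).2 fun i j hij => ?_
        show (((g * t * g⁻¹ : ↥(unitaryGroupOfForm σ J)) : GL (Fin 2) R) : Matrix (Fin 2) (Fin 2) R) i j = 0
        rw [Subgroup.coe_mul, Subgroup.coe_mul, Subgroup.coe_inv, Units.val_mul, Units.val_mul, hte]
        change (G * (diagonal fun k => (e k : R)) * G') i j = 0
        fin_cases i <;> fin_cases j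
        all_goals first
          | exact absurd rfl hij
          | simp [Matrix.mul_apply, Fin.sum_univ_two, Matrix.diagonal, hG00, hG11, hG'00, hG'11]
      · intro hconj
        obtain ⟨e, he⟩ := hconj
        have hce : (((g * t * g⁻¹ : ↥(unitaryGroupOfForm σ J)) : GL (Fin 2) R) : Matrix (Fin 2) (Fin 2) R) = diagonal fun k => (e k : R) := by
          rw [← coe_glDiagonal, he, Subgroup.coe_subtype]
        have hte : ((t : GL (Fin 2) R) : Matrix (Fin 2) (Fin 2) R) = G' * (diagonal fun k => (e k : R)) * G := by
          have e1 : t = g⁻¹ * (g * t * g⁻¹) * g := by group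
          have e2 := congrArg (fun x : ↥(unitaryGroupOfForm σ J) => ((x : GL (Fin 2) R) : Matrix (Fin 2) (Fin 2) R)) e1
          rw [e2, Subgroup.coe_mul, Subgroup.coe_mul, Subgroup.coe_inv, Units.val_mul, Units.val_mul, hce]
        refine (mem_torusU_iff_forall_apply_eq_zero σ J t).2 fun i j hij => ?_
        rw [hte]
        fin_cases i <;> fin_cases j
        all_goals first
          | exact absurd rfl hij
          | simp [Matrix.mul_apply, Fin.sum_univ_two, Matrix.diagonal, hG00, hG11, hG'00, hG'11]

end Normaliser

/-! ## §3 The Weyl element `w` (matrix `Φ₂`): `w ∉ T`, `w ∈ N(T)`, `w·(anti-diagonal) ∈ T`, and `N(T) = T ⊔ w·T` in the letter's form -/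

section Weyl

variable {R : Type*} [CommRing R] (σ : R →+* R) {J : Matrix (Fin 2) (Fin 2) R} {w : ↥(unitaryGroupOfForm σ J)}

/-- The Weyl element's matrix `Φ₂` is supported on the anti-diagonal. [cite: Rogawski1990, §1.9 p. 8] -/
theorem weyl_two_apply_eq_zero (hJ : J = (StdForm.antidiagonal 2).over R) (hw : ((w : GL (Fin 2) R) : Matrix (Fin 2) (Fin 2) R) = J)
    (i j : Fin 2) (hij : j ≠ i.rev) : ((w : GL (Fin 2) R) : Matrix (Fin 2) (Fin 2) R) i j = 0 := by
  rw [hw, hJ, antidiagonal_two_over_apply, if_neg hij]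

/-- **`w ∉ T`** (nontrivial `R`): the entry `(0, 1)` of `Φ₂` is `1 ≠ 0`, off the diagonal. [cite: Rogawski1990, §12.5 p. 182] -/
theorem weyl_two_not_mem_torusU [Nontrivial R] (hJ : J = (StdForm.antidiagonal 2).over R)
    (hw : ((w : GL (Fin 2) R) : Matrix (Fin 2) (Fin 2) R) = J) : w ∉ torusU σ J := by
  intro hwT
  have h := (mem_torusU_iff_forall_apply_eq_zero σ J w).1 hwT 0 1 (by decide)
  rw [hw, hJ, antidiagonal_two_over_apply, if_pos (by decide)] at h
  exact one_ne_zero h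

/-- **`w ∈ N(T)`** (§2, ⇐ direction: an anti-diagonal element normalises the diagonal torus; `R` field-like with a regular element in `T`).
[cite: Rogawski1990, §12.5 p. 182] [cite: SpringerLAG1998, 7.1.5] -/
theorem weyl_two_mem_normalizer [Nontrivial R] (hR : ∀ x : R, x ≠ 0 → IsUnit x) (hJ : J = (StdForm.antidiagonal 2).over R)
    (hex : ∃ m : ↥(unitaryGroupOfForm σ J), m ∈ torusU σ J ∧ IsRegularElt (m : GL (Fin 2) R))
    (hw : ((w : GL (Fin 2) R) : Matrix (Fin 2) (Fin 2) R) = J) :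
    w ∈ Subgroup.normalizer (torusU σ J : Set ↥(unitaryGroupOfForm σ J)) :=
  (mem_normalizer_torusU_two_iff σ hR hex w).2 (Or.inr (weyl_two_apply_eq_zero σ hJ hw))

/-- **`w n ∈ T` for every anti-diagonal `n ∈ U`** (anti-diagonal × anti-diagonal = diagonal, ★ `antidiag_mul_antidiag_apply_eq_zero`). [cite: Rogawski1990, §12.5 p. 182] -/
theorem weyl_two_mul_mem_torusU_of_antidiag (hJ : J = (StdForm.antidiagonal 2).over R) (hw : ((w : GL (Fin 2) R) : Matrix (Fin 2) (Fin 2) R) = J)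
    {n : ↥(unitaryGroupOfForm σ J)} (hn : ∀ i j : Fin 2, j ≠ i.rev → ((n : GL (Fin 2) R) : Matrix (Fin 2) (Fin 2) R) i j = 0) :
    w * n ∈ torusU σ J := by
  rw [mem_torusU_iff_forall_apply_eq_zero]
  intro i j hij
  rw [Subgroup.coe_mul, Units.val_mul]
  exact antidiag_mul_antidiag_apply_eq_zero (weyl_two_apply_eq_zero σ hJ hw) hn hij

/-- The same on the other side: **`n w ∈ T` for every anti-diagonal `n ∈ U`.** [cite: Rogawski1990, §12.5 p. 182] -/
theorem mul_weyl_two_mem_torusU_of_antidiag (hJ : J = (StdForm.antidiagonal 2).over R) (hw : ((w : GL (Fin 2) R) : Matrix (Fin 2) (Fin 2) R) = J)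
    {n : ↥(unitaryGroupOfForm σ J)} (hn : ∀ i j : Fin 2, j ≠ i.rev → ((n : GL (Fin 2) R) : Matrix (Fin 2) (Fin 2) R) i j = 0) :
    n * w ∈ torusU σ J := by
  rw [mem_torusU_iff_forall_apply_eq_zero]
  intro i j hij
  rw [Subgroup.coe_mul, Units.val_mul]
  exact antidiag_mul_antidiag_apply_eq_zero hn (weyl_two_apply_eq_zero σ hJ hw) hij

/-- **(B4) in the road letter's form: `n ∈ N_U(T) ↔ n ∈ T ∨ n·w ∈ T`** (`U = U(σ, Φ₂)(R)`, `R` field-like nontrivial, `T` with a regular element, `w` the Weyl unit of §1):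
«a regular diagonal forces a monomial matrix». [cite: Rogawski1990, §12.5 p. 182] [cite: SpringerLAG1998, 7.1.5] -/
theorem mem_normalizer_torusU_two_iff_mem_or_mul_weyl_mem [Nontrivial R] (hR : ∀ x : R, x ≠ 0 → IsUnit x)
    (hJ : J = (StdForm.antidiagonal 2).over R)
    (hex : ∃ m : ↥(unitaryGroupOfForm σ J), m ∈ torusU σ J ∧ IsRegularElt (m : GL (Fin 2) R))
    (hw : ((w : GL (Fin 2) R) : Matrix (Fin 2) (Fin 2) R) = J) (n : ↥(unitaryGroupOfForm σ J)) :
    n ∈ Subgroup.normalizer (torusU σ J : Set ↥(unitaryGroupOfForm σ J)) ↔ n ∈ torusU σ J ∨ n * w ∈ torusU σ J := by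
  rw [mem_normalizer_torusU_two_iff σ hR hex n]
  constructor
  · rintro (hdiag | hanti)
    · exact Or.inl ((mem_torusU_iff_forall_apply_eq_zero σ J n).2 hdiag)
    · exact Or.inr (mul_weyl_two_mem_torusU_of_antidiag σ hJ hw hanti)
  · rintro (hT | hwT)
    · exact Or.inl ((mem_torusU_iff_forall_apply_eq_zero σ J n).1 hT)
    · -- `n = (n w) w⁻¹ = (n w) w` is diagonal × anti-diagonal, hence anti-diagonal
      right
      have hnw := (mem_torusU_iff_forall_apply_eq_zero σ J (n * w)).1 hwT
      have hww : w * w = 1 := by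
        apply Subtype.ext; apply Units.ext
        rw [Subgroup.coe_mul, Units.val_mul, hw, hJ, StdForm.over_mul_over, Subgroup.coe_one, Units.val_one]
      have hn : n = n * w * w := by rw [mul_assoc, hww, mul_one]
      intro i j hij
      rw [hn, Subgroup.coe_mul, Units.val_mul, Matrix.mul_apply, Finset.sum_eq_single i]
      · rw [weyl_two_apply_eq_zero σ hJ hw i j hij, mul_zero]
      · intro k _ hki
        rw [hnw i k (Ne.symm hki), zero_mul]
      · intro h; exact absurd (Finset.mem_univ i) h

end Weyl

/-! ## §4 `[N(T) : T] = 2` — the Weyl value at the split torus of `U(Φ₂)` -/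

section Index

variable {R : Type*} [CommRing R] (σ : R →+* R) {J : Matrix (Fin 2) (Fin 2) R}

/-- **`|W| = |N(T)∕T| = 2` for `U(σ, Φ₂)(R)`** (`R` non-trivial field-like, `J = Φ₂`, a regular element in `T`): by §2 an element of `N(T)` is diagonal (∈ `T`) or anti-diagonal
(then its product with the Weyl unit `w` of §1 lies in `T`), so `Subgroup.index_eq_two_iff` applies with `a := w`.  This is the Weyl VALUE of the split Cartan `M₂` of
`U(1,1)` — the S9d ∕ (N3) number — and gives the engine's `[N(T):T] ≠ 0`. [cite: Rogawski1990, §12.5 p. 182] [cite: vanDijk1972, §2] -/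
theorem index_torusU_subgroupOf_normalizer_two_eq_two [Nontrivial R] (hR : ∀ x : R, x ≠ 0 → IsUnit x)
    (hJ : J = (StdForm.antidiagonal 2).over R)
    (hex : ∃ m : ↥(unitaryGroupOfForm σ J), m ∈ torusU σ J ∧ IsRegularElt (m : GL (Fin 2) R)) :
    ((torusU σ J).subgroupOf (Subgroup.normalizer (torusU σ J : Set ↥(unitaryGroupOfForm σ J)))).index = 2 := by
  classical
  set w : ↥(unitaryGroupOfForm σ J) :=
    ⟨(⟨J, J, by rw [hJ, StdForm.over_mul_over], by rw [hJ, StdForm.over_mul_over]⟩ : GL (Fin 2) R),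
      antidiagOne_two_mem_unitaryGroupOfForm σ hJ⟩ with hwdef
  have hw : ((w : GL (Fin 2) R) : Matrix (Fin 2) (Fin 2) R) = J := rfl
  have hwT := weyl_two_not_mem_torusU σ hJ hw
  refine Subgroup.index_eq_two_iff.2 ⟨⟨w, weyl_two_mem_normalizer σ hR hJ hex hw⟩, fun b => ?_⟩
  simp only [Subgroup.mem_subgroupOf, Subgroup.coe_mul]
  rcases (mem_normalizer_torusU_two_iff σ hR hex (b : ↥(unitaryGroupOfForm σ J))).1 b.2 with hdiag | hanti
  · have hbT : (b : ↥(unitaryGroupOfForm σ J)) ∈ torusU σ J := (mem_torusU_iff_forall_apply_eq_zero σ J _).2 hdiag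
    refine Or.inr ⟨hbT, fun hbw => hwT ?_⟩
    have := (torusU σ J).mul_mem ((torusU σ J).inv_mem hbT) hbw
    rwa [← mul_assoc, inv_mul_cancel, one_mul] at this
  · have hbw : (b : ↥(unitaryGroupOfForm σ J)) * w ∈ torusU σ J := mul_weyl_two_mem_torusU_of_antidiag σ hJ hw hanti
    refine Or.inl ⟨hbw, fun hbT => hwT ?_⟩
    have := (torusU σ J).mul_mem ((torusU σ J).inv_mem hbT) hbw
    rwa [← mul_assoc, inv_mul_cancel, one_mul] at this

/-- `[N(T) : T] ≠ 0` (the engine's `hW` BY SHAPE). [cite: Rogawski1990, §12.5 p. 182] [cite: HarishChandra1970, Lemma 42] -/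
theorem index_torusU_subgroupOf_normalizer_two_ne_zero [Nontrivial R] (hR : ∀ x : R, x ≠ 0 → IsUnit x)
    (hJ : J = (StdForm.antidiagonal 2).over R)
    (hex : ∃ m : ↥(unitaryGroupOfForm σ J), m ∈ torusU σ J ∧ IsRegularElt (m : GL (Fin 2) R)) :
    ((torusU σ J).subgroupOf (Subgroup.normalizer (torusU σ J : Set ↥(unitaryGroupOfForm σ J)))).index ≠ 0 := by
  rw [index_torusU_subgroupOf_normalizer_two_eq_two σ hR hJ hex]; exact two_ne_zero

end Index

/-! ## §5 A regular element of the split torus of `U(σ, Φ₂)` -/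

section Regular

variable {R : Type*} [CommRing R] (σ : R →+* R) {J : Matrix (Fin 2) (Fin 2) R}

/-- **`d(α, α⁻¹)` is a REGULAR element of `T`** when `σ α = α` and `α − α⁻¹` is a unit (e.g. `α` a `σ`-fixed uniformiser of a valued field): the `hex` hypothesis of §2–§4,
discharged (★ `glDiagonal_two_mem_unitaryGroupOfForm`, ★ `isRegularElt_glDiagonal_of_isUnit_sub`). [cite: Rogawski1990, §3.1 p. 19; §1.10 p. 9] -/
theorem exists_mem_torusU_isRegularElt_two (hJ : J = (StdForm.antidiagonal 2).over R) (α : Rˣ) (hα : σ α = α)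
    (hu : IsUnit ((α : R) - ((α⁻¹ : Rˣ) : R))) :
    ∃ m : ↥(unitaryGroupOfForm σ J), m ∈ torusU σ J ∧ IsRegularElt (m : GL (Fin 2) R) := by
  subst hJ
  refine ⟨⟨glDiagonal 2 R ![α, α⁻¹], glDiagonal_two_mem_unitaryGroupOfForm σ α hα⟩, ⟨![α, α⁻¹], rfl⟩, ?_⟩
  refine isRegularElt_glDiagonal_of_isUnit_sub fun i j hij => ?_
  have h := hu.neg; rw [neg_sub] at h
  fin_cases i <;> fin_cases j <;> first | exact absurd rfl hij | simpa using hu | simpa using h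

end Regular

/-! ## §6 The (E1a) kit at `(U(σ, Φ₂)(R), T, regular)`: `W`-free neighbourhoods and one-point fibres of the conjugation family -/

section Fibre

variable {R : Type*} [CommRing R] (σ : R →+* R) {J : Matrix (Fin 2) (Fin 2) R}

/-- The diagonal torus is abelian, in the (E1a) kit's letter (★ `torusU_mul_comm`). [cite: Rogawski1990, §1.10 p. 9] -/
theorem forall_mem_torusU_mul_comm : ∀ a ∈ torusU σ J, ∀ b ∈ torusU σ J, a * b = b * a :=
  fun a ha b hb => congrArg Subtype.val (torusU_mul_comm σ J ⟨a, ha⟩ ⟨b, hb⟩)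

/-- **`W`-FREE NEIGHBOURHOODS IN THE SPLIT TORUS OF `U(σ, Φ₂)(R)`** (`U` a Hausdorff topological group, `R` field-like, `J = Φ₂`, a regular element in `T`): every REGULAR
`t₀ ∈ T` has an open neighbourhood `U` in `T` whose regular part is `W`-free — no two of its points are conjugate by an element outside `T` — ★ (E1a)
`exists_isOpen_wFree_nhds` with `hRT` := ★ (A1) `centralizer_eq_torusU_of_isRegularElt`, `hW` := §4, abelian := ★ `torusU_mul_comm`.  (The `W`-free clause of the (E1b)
tube-Jacobian socket at the split Cartan.) [cite: HarishChandra1970, Lemma 42] [cite: Rogawski1990, §12.5 p. 182] -/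
theorem exists_isOpen_wFree_nhds_torusU_two [TopologicalSpace ↥(unitaryGroupOfForm σ J)] [IsTopologicalGroup ↥(unitaryGroupOfForm σ J)]
    [T2Space ↥(unitaryGroupOfForm σ J)] [Nontrivial R] (hR : ∀ x : R, x ≠ 0 → IsUnit x) (hJ : J = (StdForm.antidiagonal 2).over R)
    (hex : ∃ m : ↥(unitaryGroupOfForm σ J), m ∈ torusU σ J ∧ IsRegularElt (m : GL (Fin 2) R))
    (t₀ : ↥(torusU σ J)) (ht₀ : IsRegularElt (((t₀ : ↥(unitaryGroupOfForm σ J)) : GL (Fin 2) R))) :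
    ∃ U : Set ↥(torusU σ J), IsOpen U ∧ t₀ ∈ U ∧
      ∀ n : ↥(unitaryGroupOfForm σ J), n ∉ torusU σ J →
        ∀ t ∈ U ∩ {t : ↥(torusU σ J) | IsRegularElt (((t : ↥(unitaryGroupOfForm σ J)) : GL (Fin 2) R))},
          ∀ t' ∈ U ∩ {t : ↥(torusU σ J) | IsRegularElt (((t : ↥(unitaryGroupOfForm σ J)) : GL (Fin 2) R))},
            ((t' : ↥(torusU σ J)) : ↥(unitaryGroupOfForm σ J)) ≠ n * t * n⁻¹ :=
  exists_isOpen_wFree_nhds (torusU σ J) (forall_mem_torusU_mul_comm σ)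
    {x : ↥(unitaryGroupOfForm σ J) | IsRegularElt ((x : GL (Fin 2) R))}
    (fun t ht => centralizer_eq_torusU_of_isRegularElt σ J t.2 ht) (index_torusU_subgroupOf_normalizer_two_ne_zero σ hR hJ hex) t₀ ht₀

/-- **ONE-POINT FIBRES OF THE CONJUGATION FAMILY OVER A `W`-FREE SET**, `InjOn` form (the injectivity input of the tube-Jacobian socket, ★ `TubeIdentityPiSystemReduction`'s
shape): `Φ(x̄, t) = x t x⁻¹` is injective on `A₀ ×ˢ V` for every `W`-free `V ⊆ T` — ★ (E1a) `subsingleton_preimage_inter_prod` at the abelian `T = torusU σ J` (any `R`, `σ`, `J`).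
[cite: HarishChandra1970, Lemma 22; Lemma 42] -/
theorem injOn_conjFamily_torusU (Φ : (↥(unitaryGroupOfForm σ J) ⧸ torusU σ J) × ↥(torusU σ J) → ↥(unitaryGroupOfForm σ J))
    (hΦ : ∀ (x : ↥(unitaryGroupOfForm σ J)) (t : ↥(torusU σ J)), Φ (QuotientGroup.mk x, t) = x * t * x⁻¹)
    {V : Set ↥(torusU σ J)}
    (hV : ∀ n : ↥(unitaryGroupOfForm σ J), n ∉ torusU σ J → ∀ t ∈ V, ∀ t' ∈ V, ((t' : ↥(torusU σ J)) : ↥(unitaryGroupOfForm σ J)) ≠ n * t * n⁻¹)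
    (A₀ : Set (↥(unitaryGroupOfForm σ J) ⧸ torusU σ J)) :
    Set.InjOn Φ (A₀ ×ˢ V) := fun _ hp q hq hpq =>
  subsingleton_preimage_inter_prod (torusU σ J) (forall_mem_torusU_mul_comm σ) Φ hΦ hV A₀ (Φ q) ⟨hpq, hp⟩ ⟨rfl, hq⟩

end Fibre

end Summit.HodgeConjecture.HodgeConjecture.Cruxes.H413.F0P3cStCharTSUpTrU2Norm
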